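import Summits.FinalStateConjecture.FinalStateConjecture.Theorems.EIHFluxBalanceInertialRecessionRechartWhiteHoleKerrAlgebra
import Summits.FinalStateConjecture.FinalStateConjecture.Theorems.EIHFluxBalanceInertialRecessionRechartWhiteHoleKinematics

/-!
# Route EIHFluxBalance — `InertialRecession`, re-charting: drift of frame, inverse frame,
# painted velocity and centre over bounded lab-time windows (white-hole exclusion, rotating holes)

Helper file for the crux `stmt-FinalStateConjecture-10166`
(`Summit.FinalStateConjecture.FinalStateConjecture.Theses.EIHFluxBalance.InertialRecession`),
stub `stub_rechart` of line `sublinear-is-free-clean-window-charges`.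

The velocity-free white-hole exclusion freezes the painted frame only over the BOUNDED lab-time
window of the escape segment. With `Q(t)` a (normalised) painted frame whose derivative tends to
`0` in operator norm:
* `exists_window_le_of_tendsto_deriv` — `‖Q(t) − Q(t₀)‖ ≤ δ` for `|t − t₀| ≤ L`, `t₀` late
  (mean value inequality);
* `norm_symm_sub_symm_le` — `‖Q₁⁻¹ − Q₂⁻¹‖ ≤ ‖Q₁⁻¹‖‖Q₁ − Q₂‖‖Q₂⁻¹‖`
  (`Q₁⁻¹ − Q₂⁻¹ = Q₁⁻¹(Q₂ − Q₁)Q₂⁻¹`);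
* `norm_labVelocity_sub_le` — the painted lab velocity `v(Q) = (Qe₀)~/(Qe₀)⁰` is Lipschitz in the
  frame: `‖v(Q₁) − v(Q₂)‖ ≤ (1 + ‖Q₂‖)‖Q₁ − Q₂‖`;
* `exists_centre_drift_le` — with the slaved mismatch `ξ̇ − v(Q) → 0`:
  `‖ξ(t) − ξ(t₀) − (t − t₀)v(Q(t₀))‖ ≤ ε` on late windows;
* `offset_model_eq` — the offset of the lab segment point `c₀ + Λ₀b₀ + sΛ₀w₀` from the uniformly
  moving model centre `(T, ξ₀ + (T − t₀)v₀)` is `Λ₀(b₀ + s w₀ − ((T − t₀)/u₀⁰)e₀)`;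
* `exists_farField_bound_spin` — far field of one painted Kerr hole, `C⁰`, general spin.

[O'Neill 1983, Ch. 9, pp. 233–236; folklore]
-/

noncomputable section

set_option linter.dupNamespace false

open Set Function Metric Filter Topology Literature.Geometry.Lorentzian

namespace Summit.FinalStateConjecture.FinalStateConjecture.Theorems

/-! ### Windows -/

/-- **Window control from a vanishing derivative**: if `f` is differentiable with `f' → 0`, then
for `L, δ > 0` and late `t₀`, `‖f(t) − f(t₀)‖ ≤ δ` whenever `|t − t₀| ≤ L`. [folklore] -/
theorem exists_window_le_of_tendsto_deriv {F : Type*} [NormedAddCommGroup F] [NormedSpace ℝ F]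
    {f : ℝ → F} (hf : Differentiable ℝ f) (h : Tendsto (deriv f) atTop (𝓝 0)) {L δ : ℝ}
    (hL : 0 < L) (hδ : 0 < δ) :
    ∃ T : ℝ, ∀ t₀ t : ℝ, T ≤ t₀ → |t - t₀| ≤ L → ‖f t - f t₀‖ ≤ δ := by
  have hδL : 0 < δ / L := by positivity
  obtain ⟨T, hT⟩ := (Metric.tendsto_atTop.mp h) (δ / L) hδL
  refine ⟨T + L, fun t₀ t ht₀ ht ↦ ?_⟩
  have hbound : ∀ s ∈ Ici T, ‖deriv f s‖ ≤ δ / L := fun s hs ↦ by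
    have := hT s hs
    rw [dist_zero_right] at this
    exact this.le
  have ht₀T : t₀ ∈ Ici T := by show T ≤ t₀; linarith
  have htT : t ∈ Ici T := by
    show T ≤ t
    have := (abs_le.mp ht).1; linarith
  have hmv := (convex_Ici T).norm_image_sub_le_of_norm_deriv_le (fun s _ ↦ hf s) hbound ht₀T htT
  calc ‖f t - f t₀‖ ≤ δ / L * ‖t - t₀‖ := hmv
    _ ≤ δ / L * L := by
        refine mul_le_mul_of_nonneg_left ?_ hδL.le
        rw [Real.norm_eq_abs]; exact ht
    _ = δ := by field_simp

/-! ### Inverse frames -/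

/-- `Q₁⁻¹ − Q₂⁻¹ = Q₁⁻¹ ∘ (Q₂ − Q₁) ∘ Q₂⁻¹` for continuous linear equivalences. [folklore] -/
theorem symm_sub_symm_eq (Q₁ Q₂ : E4 ≃L[ℝ] E4) :
    ((Q₁.symm : E4 ≃L[ℝ] E4) : E4 →L[ℝ] E4) - ((Q₂.symm : E4 ≃L[ℝ] E4) : E4 →L[ℝ] E4) =
      ((Q₁.symm : E4 ≃L[ℝ] E4) : E4 →L[ℝ] E4).comp
        ((((Q₂ : E4 →L[ℝ] E4)) - (Q₁ : E4 →L[ℝ] E4)).comp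
          ((Q₂.symm : E4 ≃L[ℝ] E4) : E4 →L[ℝ] E4)) := by
  ext v
  simp only [FunLike.coe_sub, Pi.sub_apply, ContinuousLinearMap.coe_comp, comp_apply,
    ContinuousLinearEquiv.coe_coe, map_sub, ContinuousLinearEquiv.apply_symm_apply,
    ContinuousLinearEquiv.symm_apply_apply]

/-- **Drift of the inverse frame**: `‖Q₁⁻¹ − Q₂⁻¹‖ ≤ ‖Q₁⁻¹‖ ‖Q₁ − Q₂‖ ‖Q₂⁻¹‖`. [folklore] -/
theorem norm_symm_sub_symm_le (Q₁ Q₂ : E4 ≃L[ℝ] E4) :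
    ‖((Q₁.symm : E4 ≃L[ℝ] E4) : E4 →L[ℝ] E4) - ((Q₂.symm : E4 ≃L[ℝ] E4) : E4 →L[ℝ] E4)‖ ≤
      ‖((Q₁.symm : E4 ≃L[ℝ] E4) : E4 →L[ℝ] E4)‖ * ‖(Q₁ : E4 →L[ℝ] E4) - (Q₂ : E4 →L[ℝ] E4)‖ *
        ‖((Q₂.symm : E4 ≃L[ℝ] E4) : E4 →L[ℝ] E4)‖ := by
  rw [symm_sub_symm_eq]
  refine (ContinuousLinearMap.opNorm_comp_le _ _).trans ?_
  rw [mul_assoc]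
  refine mul_le_mul_of_nonneg_left ?_ (norm_nonneg _)
  refine (ContinuousLinearMap.opNorm_comp_le _ _).trans ?_
  rw [← norm_neg ((Q₂ : E4 →L[ℝ] E4) - (Q₁ : E4 →L[ℝ] E4)), neg_sub]

/-! ### The painted lab velocity is Lipschitz in the frame -/

/-- `‖Qe₀ − Q'e₀‖ ≤ ‖Q − Q'‖`. [folklore] -/
theorem norm_apply_basisVector_zero_sub_le (Q₁ Q₂ : E4 →L[ℝ] E4) :
    ‖Q₁ (E4.basisVector 0) - Q₂ (E4.basisVector 0)‖ ≤ ‖Q₁ - Q₂‖ := by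
  have h : Q₁ (E4.basisVector 0) - Q₂ (E4.basisVector 0) = (Q₁ - Q₂) (E4.basisVector 0) := by
    rw [FunLike.coe_sub, Pi.sub_apply]
  rw [h]
  refine ((Q₁ - Q₂).le_opNorm _).trans ?_
  rw [PiLp.norm_single, norm_one, mul_one]

/-- `|u⁰ − u'⁰| ≤ ‖u − u'‖` and `‖u~ − u'~‖ ≤ ‖u − u'‖`. [folklore] -/
theorem abs_apply_zero_sub_le_norm (u u' : E4) :
    |u 0 - u' 0| ≤ ‖u - u'‖ ∧ ‖E4.spatial u - E4.spatial u'‖ ≤ ‖u - u'‖ := by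
  have h := norm_sq_eq_sq_add_spatialNorm_sq (u - u')
  have hsp : E4.spatialNorm (u - u') = ‖E4.spatial u - E4.spatial u'‖ := by
    rw [E4.spatialNorm, map_sub]
  rw [hsp, PiLp.sub_apply] at h
  constructor
  · have h1 : |u 0 - u' 0| ^ 2 ≤ ‖u - u'‖ ^ 2 := by
      rw [sq_abs]; nlinarith [sq_nonneg ‖E4.spatial u - E4.spatial u'‖]
    exact (sq_le_sq₀ (abs_nonneg _) (norm_nonneg _)).mp h1
  · have h2 : ‖E4.spatial u - E4.spatial u'‖ ^ 2 ≤ ‖u - u'‖ ^ 2 := by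
      nlinarith [sq_nonneg (u 0 - u' 0)]
    exact (sq_le_sq₀ (norm_nonneg _) (norm_nonneg _)).mp h2

/-- **The painted lab velocity is Lipschitz in the frame**: for `u = Qe₀`, `u' = Q'e₀` with
`|u⁰|, |u'⁰| ≥ 1`, `‖u~/u⁰ − u'~/u'⁰‖ ≤ (1 + ‖u'‖) ‖u − u'‖`. [folklore] -/
theorem norm_labVelocity_sub_le {u u' : E4} (hu : 1 ≤ |u 0|) (hu' : 1 ≤ |u' 0|) :
    ‖(u 0)⁻¹ • E4.spatial u - (u' 0)⁻¹ • E4.spatial u'‖ ≤ (1 + ‖u'‖) * ‖u - u'‖ := by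
  obtain ⟨h0, hsp⟩ := abs_apply_zero_sub_le_norm u u'
  have hu0 : u 0 ≠ 0 := fun h ↦ by rw [h, abs_zero] at hu; linarith
  have hu0' : u' 0 ≠ 0 := fun h ↦ by rw [h, abs_zero] at hu'; linarith
  have hsplit : (u 0)⁻¹ • E4.spatial u - (u' 0)⁻¹ • E4.spatial u' =
      (u 0)⁻¹ • (E4.spatial u - E4.spatial u') + ((u 0)⁻¹ - (u' 0)⁻¹) • E4.spatial u' := by
    rw [smul_sub, sub_smul]; abel
  have hinv : |(u 0)⁻¹| ≤ 1 := by rw [abs_inv]; exact inv_le_one_of_one_le₀ hu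
  have hdiff : |(u 0)⁻¹ - (u' 0)⁻¹| ≤ ‖u - u'‖ := by
    rw [inv_sub_inv hu0 hu0', abs_div, abs_mul]
    have h1 : 1 ≤ |u 0| * |u' 0| := one_le_mul_of_one_le_of_one_le hu hu'
    calc |u' 0 - u 0| / (|u 0| * |u' 0|) ≤ |u' 0 - u 0| / 1 :=
          div_le_div_of_nonneg_left (abs_nonneg _) one_pos h1
      _ ≤ ‖u - u'‖ := by rw [div_one, abs_sub_comm]; exact h0
  have hsp' : ‖E4.spatial u'‖ ≤ ‖u'‖ := by
    have h := norm_sq_eq_sq_add_spatialNorm_sq u'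
    rw [E4.spatialNorm] at h
    refine (sq_le_sq₀ (norm_nonneg _) (norm_nonneg _)).mp ?_
    nlinarith [sq_nonneg (u' 0)]
  rw [hsplit]
  calc ‖(u 0)⁻¹ • (E4.spatial u - E4.spatial u') + ((u 0)⁻¹ - (u' 0)⁻¹) • E4.spatial u'‖
      ≤ ‖(u 0)⁻¹ • (E4.spatial u - E4.spatial u')‖ + ‖((u 0)⁻¹ - (u' 0)⁻¹) • E4.spatial u'‖ :=
        norm_add_le _ _
    _ = |(u 0)⁻¹| * ‖E4.spatial u - E4.spatial u'‖ + |(u 0)⁻¹ - (u' 0)⁻¹| * ‖E4.spatial u'‖ := by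
        rw [norm_smul, norm_smul, Real.norm_eq_abs, Real.norm_eq_abs]
    _ ≤ 1 * ‖u - u'‖ + ‖u - u'‖ * ‖u'‖ := by
        gcongr
    _ = (1 + ‖u'‖) * ‖u - u'‖ := by ring

/-! ### Drift of the centre -/

/-- **Centre drift from the slaved mismatch and frame drift.** Let `ξ` be differentiable with
mismatch `ξ̇(t) − v(Q(t)) → 0`, `v(Q) = (Qe₀)~/(Qe₀)⁰`, for frames `Q(t)` of operator norm `≤ Γ`,
with `|(Q(t)e₀)⁰| ≥ 1`, whose drift over windows of length `L` is eventually `≤ δ` for every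
`δ > 0`. Then for `ε > 0` and late `t₀`: `‖ξ(t) − ξ(t₀) − (t − t₀)v(Q(t₀))‖ ≤ ε` whenever
`|t − t₀| ≤ L`. [folklore] -/
theorem exists_centre_drift_le {ξ : ℝ → E3} (hξ : Differentiable ℝ ξ) (Q : ℝ → lorentzGroup)
    (hmis : Tendsto (fun t ↦ deriv ξ t - ((((Q t : E4 ≃L[ℝ] E4) (E4.basisVector 0)) 0)⁻¹ •
      E4.spatial ((Q t : E4 ≃L[ℝ] E4) (E4.basisVector 0)))) atTop (𝓝 0))
    {Γ : ℝ} (hΓ : ∀ t, ‖((Q t : E4 ≃L[ℝ] E4) : E4 →L[ℝ] E4)‖ ≤ Γ) {L : ℝ} (hL : 0 < L)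
    (hdrift : ∀ δ : ℝ, 0 < δ → ∃ T : ℝ, ∀ t₀ t : ℝ, T ≤ t₀ → |t - t₀| ≤ L →
      ‖((Q t : E4 ≃L[ℝ] E4) : E4 →L[ℝ] E4) - ((Q t₀ : E4 ≃L[ℝ] E4) : E4 →L[ℝ] E4)‖ ≤ δ)
    {ε : ℝ} (hε : 0 < ε) :
    ∃ T : ℝ, ∀ t₀ t : ℝ, T ≤ t₀ → |t - t₀| ≤ L →
      ‖ξ t - ξ t₀ - (t - t₀) • (((((Q t₀ : E4 ≃L[ℝ] E4) (E4.basisVector 0)) 0)⁻¹ •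
        E4.spatial ((Q t₀ : E4 ≃L[ℝ] E4) (E4.basisVector 0))))‖ ≤ ε := by
  -- notation for the painted velocity
  set v : ℝ → E3 := fun t ↦ ((((Q t : E4 ≃L[ℝ] E4) (E4.basisVector 0)) 0)⁻¹ •
    E4.spatial ((Q t : E4 ≃L[ℝ] E4) (E4.basisVector 0))) with hv
  have hΓ0 : 0 ≤ Γ := (norm_nonneg _).trans (hΓ 0)
  -- thresholds
  have hε2 : 0 < ε / (2 * L) := by positivity
  obtain ⟨Tm, hTm⟩ := (Metric.tendsto_atTop.mp hmis) (ε / (2 * L)) hε2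
  have hδ : 0 < ε / (2 * L * (2 + Γ)) := by positivity
  obtain ⟨Td, hTd⟩ := hdrift _ hδ
  refine ⟨max (Tm + L) Td, fun t₀ t ht₀ ht ↦ ?_⟩
  have ht₀m : Tm + L ≤ t₀ := (le_max_left _ _).trans ht₀
  have ht₀d : Td ≤ t₀ := (le_max_right _ _).trans ht₀
  -- the comparison function
  set g : ℝ → E3 := fun s ↦ ξ s - s • v t₀ with hg
  have hgd : ∀ s, HasDerivAt g (deriv ξ s - v t₀) s := fun s ↦
    (hξ s).hasDerivAt.sub ((hasDerivAt_id s).smul_const (v t₀) |>.congr_deriv (by simp))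
  have hbound : ∀ s ∈ Icc (t₀ - L) (t₀ + L), ‖deriv g s‖ ≤ ε / L := by
    intro s hs
    rw [(hgd s).deriv]
    have hsL : |s - t₀| ≤ L := abs_le.mpr ⟨by linarith [hs.1], by linarith [hs.2]⟩
    have h1 : ‖deriv ξ s - v s‖ ≤ ε / (2 * L) := by
      have := hTm s (by linarith [hs.1])
      rw [dist_zero_right] at this
      exact this.le
    have h2 : ‖v s - v t₀‖ ≤ ε / (2 * L) := by
      have hu : 1 ≤ |((Q s : E4 ≃L[ℝ] E4) (E4.basisVector 0)) 0| := one_le_abs_lorentz_apply_zero _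
      have hu' : 1 ≤ |((Q t₀ : E4 ≃L[ℝ] E4) (E4.basisVector 0)) 0| :=
        one_le_abs_lorentz_apply_zero _
      have h3 := norm_labVelocity_sub_le hu hu'
      have h4 : ‖(Q s : E4 ≃L[ℝ] E4) (E4.basisVector 0) - (Q t₀ : E4 ≃L[ℝ] E4) (E4.basisVector 0)‖ ≤
          ε / (2 * L * (2 + Γ)) :=
        (norm_apply_basisVector_zero_sub_le ((Q s : E4 ≃L[ℝ] E4) : E4 →L[ℝ] E4)
          ((Q t₀ : E4 ≃L[ℝ] E4) : E4 →L[ℝ] E4)).trans (hTd t₀ s ht₀d hsL)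
      have h5 : ‖(Q t₀ : E4 ≃L[ℝ] E4) (E4.basisVector 0)‖ ≤ Γ := by
        refine (((Q t₀ : E4 ≃L[ℝ] E4) : E4 →L[ℝ] E4).le_opNorm _).trans ?_
        rw [PiLp.norm_single, norm_one, mul_one]; exact hΓ t₀
      calc ‖v s - v t₀‖ ≤ (1 + ‖(Q t₀ : E4 ≃L[ℝ] E4) (E4.basisVector 0)‖) *
            ‖(Q s : E4 ≃L[ℝ] E4) (E4.basisVector 0) - (Q t₀ : E4 ≃L[ℝ] E4) (E4.basisVector 0)‖ := h3
        _ ≤ (2 + Γ) * (ε / (2 * L * (2 + Γ))) := by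
            refine mul_le_mul (by linarith) h4 (norm_nonneg _) (by linarith)
        _ = ε / (2 * L) := by field_simp
    calc ‖deriv ξ s - v t₀‖ = ‖(deriv ξ s - v s) + (v s - v t₀)‖ := by rw [sub_add_sub_cancel]
      _ ≤ ‖deriv ξ s - v s‖ + ‖v s - v t₀‖ := norm_add_le _ _
      _ ≤ ε / (2 * L) + ε / (2 * L) := add_le_add h1 h2
      _ = ε / L := by field_simp; ring
  have ht₀I : t₀ ∈ Icc (t₀ - L) (t₀ + L) := ⟨by linarith, by linarith⟩
  have htI : t ∈ Icc (t₀ - L) (t₀ + L) := ⟨by linarith [(abs_le.mp ht).1], by linarith [(abs_le.mp ht).2]⟩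
  have hmv := (convex_Icc (t₀ - L) (t₀ + L)).norm_image_sub_le_of_norm_deriv_le
    (fun s _ ↦ (hgd s).differentiableAt) hbound ht₀I htI
  have heq : g t - g t₀ = ξ t - ξ t₀ - (t - t₀) • v t₀ := by
    simp only [hg, sub_smul]; abel
  rw [heq] at hmv
  have hεL : 0 ≤ ε / L := by positivity
  calc ‖ξ t - ξ t₀ - (t - t₀) • v t₀‖ ≤ ε / L * ‖t - t₀‖ := hmv
    _ ≤ ε / L * L := by
        refine mul_le_mul_of_nonneg_left ?_ hεL
        rw [Real.norm_eq_abs]; exact ht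
    _ = ε := by field_simp

/-! ### The offset of the segment point from the uniformly moving model centre -/

/-- `u = u⁰ (1, v(u))` for `u = Λe₀`: `((u⁰)⁻¹ • u... )`; precisely
`(t/u⁰) • u = t • (1, u~/u⁰)`. [folklore] -/
theorem div_smul_fourVelocity (Λ : lorentzGroup) (t : ℝ) :
    (t / ((Λ : E4 ≃L[ℝ] E4) (E4.basisVector 0)) 0) • ((Λ : E4 ≃L[ℝ] E4) (E4.basisVector 0)) =
      t • E4.ofTimeSpace 1 (((((Λ : E4 ≃L[ℝ] E4) (E4.basisVector 0)) 0)⁻¹ •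
        E4.spatial ((Λ : E4 ≃L[ℝ] E4) (E4.basisVector 0)))) := by
  set u : E4 := (Λ : E4 ≃L[ℝ] E4) (E4.basisVector 0) with hu
  have h0 : u 0 ≠ 0 := by
    have h := one_le_abs_lorentz_apply_zero Λ
    rw [← hu] at h
    intro h'; rw [h', abs_zero] at h; linarith
  have hdec : u = (u 0) • E4.ofTimeSpace 1 ((u 0)⁻¹ • E4.spatial u) := by
    have h1 := E4.ofTimeSpace_time_spatial u
    conv_lhs => rw [← h1]
    ext μ
    refine Fin.cases ?_ (fun i ↦ ?_) μ
    · simp [E4.ofTimeSpace_apply_zero]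
    · rw [E4.ofTimeSpace_apply_succ, PiLp.smul_apply, E4.ofTimeSpace_apply_succ, PiLp.smul_apply,
        smul_eq_mul, smul_eq_mul, ← mul_assoc, mul_inv_cancel₀ h0, one_mul]
  have h1 : (t / u 0) • u = (t / u 0) • ((u 0) • E4.ofTimeSpace 1 ((u 0)⁻¹ • E4.spatial u)) :=
    congrArg (fun w : E4 ↦ (t / u 0) • w) hdec
  rw [h1, smul_smul, div_mul_cancel₀ _ h0]

/-- **The offset of the lab segment point from the uniformly moving model centre.** With
`c₀ = (t₀, ξ₀)`, `u₀ = Λ₀e₀`, `v₀ = u₀~/u₀⁰`, `x = c₀ + Λ₀b₀ + sΛ₀w₀` and `T = x⁰`: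
`x − (T, ξ₀ + (T − t₀)v₀) = Λ₀(b₀ + s w₀ − ((T − t₀)/u₀⁰) e₀)`. [folklore] -/
theorem offset_model_eq (Λ₀ : lorentzGroup) (t₀ : ℝ) (ξ₀ : E3) (b₀ w₀ : E4) (s : ℝ) {x : E4} {T : ℝ}
    (hx : x = E4.ofTimeSpace t₀ ξ₀ + (Λ₀ : E4 ≃L[ℝ] E4) b₀ + s • (Λ₀ : E4 ≃L[ℝ] E4) w₀)
    (hT : x 0 = T) :
    x - E4.ofTimeSpace T (ξ₀ + (T - t₀) • (((((Λ₀ : E4 ≃L[ℝ] E4) (E4.basisVector 0)) 0)⁻¹ •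
        E4.spatial ((Λ₀ : E4 ≃L[ℝ] E4) (E4.basisVector 0))))) =
      (Λ₀ : E4 ≃L[ℝ] E4) (b₀ + s • w₀ -
        ((T - t₀) / ((Λ₀ : E4 ≃L[ℝ] E4) (E4.basisVector 0)) 0) • E4.basisVector 0) := by
  have hc : E4.ofTimeSpace T (ξ₀ + (T - t₀) • (((((Λ₀ : E4 ≃L[ℝ] E4) (E4.basisVector 0)) 0)⁻¹ •
      E4.spatial ((Λ₀ : E4 ≃L[ℝ] E4) (E4.basisVector 0))))) =
      E4.ofTimeSpace t₀ ξ₀ + (T - t₀) • E4.ofTimeSpace 1 (((((Λ₀ : E4 ≃L[ℝ] E4)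
        (E4.basisVector 0)) 0)⁻¹ • E4.spatial ((Λ₀ : E4 ≃L[ℝ] E4) (E4.basisVector 0)))) := by
    rw [ofTimeSpace_add_smul]; congr 1; ring
  rw [hc, ← div_smul_fourVelocity, map_sub, map_add, map_smul, map_smul, hx]
  have := hT
  abel

/-! ### The far field of one painted hole, general spin -/

/-- **Far-field bound of one painted Kerr hole, `C⁰`**: for continuous centre and frame (the
inverse frame bounded by `Γ` in operator norm), on the lab slab `x⁰ = t` at lab distance
`≥ max 1 (2|a|)` from the centre, `‖g_{Λ(t),(t,ξ(t)),M,a}(x) − η‖ ≤ |M| C/‖x̲ − ξ(t)‖` — the `m = 0`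
case of `exists_norm_iteratedFDeriv_ansatzSummand_le'`. Kerr–Schild 1965, §3. [folklore] -/
theorem exists_farField_bound_spin {Γ : ℝ} (hΓ : 1 ≤ Γ) :
    ∃ C : ℝ, 0 ≤ C ∧ ∀ (M a : ℝ) (Λ : ℝ → lorentzGroup) (ξ : ℝ → E3) (t : ℝ) (x : E4),
      Continuous (fun s ↦ (((Λ s : E4 ≃L[ℝ] E4).symm : E4 →L[ℝ] E4))) → Continuous ξ →
      (∀ s, ‖(((Λ s : E4 ≃L[ℝ] E4).symm : E4 →L[ℝ] E4))‖ ≤ Γ) →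
      x 0 = t → max 1 (2 * |a|) ≤ ‖E4.spatial x - ξ t‖ →
      ‖boostedKerrBilin (Λ t) (E4.ofTimeSpace t (ξ t)) M a x - Minkowski.bilin‖ ≤
        |M| * C / ‖E4.spatial x - ξ t‖ := by
  obtain ⟨C, hC0, hC⟩ := exists_norm_iteratedFDeriv_ansatzSummand_le' 0 hΓ
  refine ⟨C, hC0, fun M a Λ ξ t x hΛ hξ hΛb hx hd ↦ ?_⟩
  have h := hC M a Λ ξ t x (contDiff_zero.mpr hΛ) (contDiff_zero.mpr hξ)
    (fun k hk ↦ by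
      have hk0 : k = 0 := Nat.le_zero.mp hk
      subst hk0
      rw [iteratedDeriv_zero]; exact hΛb t)
    (fun k hk1 hk0 ↦ by omega) hx hd
  rwa [norm_iteratedFDeriv_zero, hx] at h

/-- Registered one-line form (stub `window_le_of_tendsto_deriv_rechart` of the crux item) of
`exists_window_le_of_tendsto_deriv`. [folklore] -/
theorem window_le_of_tendsto_deriv_rechart : open Filter Topology in ∀ {F : Type*} [NormedAddCommGroup F] [NormedSpace ℝ F] {f : ℝ → F}, Differentiable ℝ f → Tendsto (deriv f) atTop (𝓝 0) → ∀ {L δ : ℝ}, 0 < L → 0 < δ → ∃ T : ℝ, ∀ t₀ t : ℝ, T ≤ t₀ → |t - t₀| ≤ L → ‖f t - f t₀‖ ≤ δ :=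
  fun hf h _ _ hL hδ ↦ exists_window_le_of_tendsto_deriv hf h hL hδ

end Summit.FinalStateConjecture.FinalStateConjecture.Theorems
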